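import Summits.Schanuel.Schanuel.Theses.RigidCore
import Literature.NumberTheory.Transcendental.ExpPointsExamples
import Summits.Schanuel.Schanuel.Theorems.RigidCoreSparsityTwoNonRealJetFinite
import Summits.Schanuel.Schanuel.Theorems.RigidCoreSparsityTwoCuspZeroLogDensity
import Summits.Schanuel.Schanuel.Theorems.RigidCoreSparsityTwoClassicalClassesFinite

/-!
# `RigidCore.SparsityTwo` from the three atoms, modulo the named parts of the line (composition, lead c2)

Line `cusp-germ-schneider-sparsity` of the crux `RigidCore.SparsityTwo` (item stmt-Schanuel-0971).
`sparsityTwo_of_atoms_of_parts`: the route decl `Summit.Schanuel.Schanuel.Theses.RigidCore.SparsityTwo` follows from the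
REGISTERED statements (verbatim, as hypotheses) of
* the shifted Runge lemma `rationalJetShift_eventually_zero` (LANDED, `RigidCoreSparsityTwoSplitLemmas` p106825),
* the split `rayHits_finite_of_split'` (`RigidCoreSparsityTwoSplit`, landing),
* E⁺ `stub_cuspEscapeAlg` (LANDED p83805) and the deep pocket `stub_deepCuspFinite` (LANDED p87226),
* the three OPEN atoms A3 `stub_wildCuspAtom`, A2 `stub_inhomogeneousCuspAtom`, A1 `stub_linearCuspAtom`,
and imports H `stub_classicalClassesFinite` (p75576), Im `stub_nonRealJetFinite` (p72083), S `stub_cuspZeroLogDensity` (p74698).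
The named parts are hypotheses (not imports) only so that this composition does not wait for the hub builds of their modules;
`RigidCoreSparsityTwoOfAtoms.lean` discharges them by name, leaving the glue `A3 → A2 → A1 → SparsityTwo`.
Composition (gen c1's `SparsityTwo_of_statements`): by contradiction the independent points are infinite; E⁺ relocates them to a
normalised log-free cusp ray with algebraic uniformisation (1), a degenerate section (2) or a constant-exponential fibre (3); (2), (3)
contradict H; in (1) a `q(N) + c` jet makes `g ≡ 0` (shifted Runge) contradicting transcendence, a non-real jet or tail contradicts
Im, and otherwise S supplies lacunarity and the split the finiteness of the (infinite) ray hits, the atoms being fed to the split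
SPECIALISED to the cusp by plain application. No unproved facts; axioms standard.
-/

set_option linter.dupNamespace false

namespace Summit.Schanuel.Schanuel.Cruxes.SparsityTwo.CuspGermSchneiderSparsity

open Filter Topology Complex Polynomial Literature.NumberTheory.Transcendental
open scoped Real

/-- **Rational jet up to a constant: the tail vanishes** (the Runge branch of the composition; the file's registered
anchor). If the polar jet is `A(w N) = q(N) + c` (`q ∈ ℚ[X]`) and infinitely many ray points `N` of a set `S` are hits
(`A(w N) + g(σ_N) ∈ ℤ`), then the tail `g` (analytic at `0`, `g 0 = 0`) vanishes near `0` — by the shifted Runge lemma, passed as the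
hypothesis `hRunge` (registered statement of `rationalJetShift_eventually_zero`, `RigidCoreSparsityTwoSplitLemmas`). In the
composition this contradicts the transcendence of the tail. -/
theorem tail_eventually_zero_of_ratJet_rayHits :
    (∀ (e : ℕ), 0 < e → ∀ (q : Polynomial ℚ) (c : ℂ) (g : ℂ → ℂ), AnalyticAt ℂ g 0 → g 0 = 0 →
      Set.Infinite {N : ℕ | ∃ L : ℤ,
        (q.map (algebraMap ℚ ℂ)).eval (N : ℂ) + c + g ((((N : ℝ) ^ ((e : ℝ)⁻¹) : ℝ) : ℂ))⁻¹ = L} →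
      ∀ᶠ z in 𝓝 (0 : ℂ), g z = 0) →
    ∀ (e : ℕ) (A : Polynomial ℂ) (g : ℂ → ℂ) (q : Polynomial ℚ) (c : ℂ) (S : Set ℕ),
      0 < e → AnalyticAt ℂ g 0 → g 0 = 0 →
      (∀ N : ℕ, A.eval ((((N : ℝ) ^ ((e : ℝ)⁻¹) : ℝ) : ℂ)) = (q.map (algebraMap ℚ ℂ)).eval (N : ℂ) + c) →
      S.Infinite →
      (∀ N ∈ S, ∃ L : ℤ, A.eval ((((N : ℝ) ^ ((e : ℝ)⁻¹) : ℝ) : ℂ)) + g ((((N : ℝ) ^ ((e : ℝ)⁻¹) : ℝ) : ℂ))⁻¹ = L) →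
      ∀ᶠ z in 𝓝 (0 : ℂ), g z = 0 := by
  intro hRunge e A g q c S he hg hg0 hq hinf hS
  refine hRunge e he q c g hg hg0 (hinf.mono ?_)
  intro N hN
  obtain ⟨L, hL⟩ := hS N hN
  refine ⟨L, ?_⟩
  rw [← hq N]
  exact hL

/-- **The crux from the atoms, modulo the named parts of the line.** Hypotheses, in order: the registered statements of
`rationalJetShift_eventually_zero`, `rayHits_finite_of_split'`, `stub_cuspEscapeAlg`, `stub_deepCuspFinite`,
`stub_wildCuspAtom`, `stub_inhomogeneousCuspAtom`, `stub_linearCuspAtom` (verbatim); conclusion: the route decl by name. -/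
theorem sparsityTwo_of_atoms_of_parts :
    (∀ (e : ℕ), 0 < e → ∀ (q : Polynomial ℚ) (c : ℂ) (g : ℂ → ℂ), AnalyticAt ℂ g 0 → g 0 = 0 →
      Set.Infinite {N : ℕ | ∃ L : ℤ,
        (q.map (algebraMap ℚ ℂ)).eval (N : ℂ) + c + g ((((N : ℝ) ^ ((e : ℝ)⁻¹) : ℝ) : ℂ))⁻¹ = L} →
      ∀ᶠ z in 𝓝 (0 : ℂ), g z = 0) →
    (∀ (W : Set (Fin 2 ⊕ Fin 2 → ℂ)), IsDefinedOver (⊥ : Subfield ℂ) W → zariskiDim ℂ W < 2 →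
      ∀ (s : Fin 2 ≃ Fin 2) (e : ℕ) (A : Polynomial ℂ) (g ℓu ℓv : ℂ → ℂ) (ρ : ℝ)
        (N₀ : ℕ) (T ℓ₀ ℓ₁ Φ₁ : ℂ → ℂ) (r : ℝ),
        let w : ℕ → ℂ := fun N => (((N : ℝ) ^ ((e : ℝ)⁻¹) : ℝ) : ℂ);
        let x' : ℕ → Fin 2 → ℂ := fun N =>
          ![2 * ↑π * I * (N : ℂ) + ℓu (w N)⁻¹, 2 * ↑π * I * (A.eval (w N) + g (w N)⁻¹) + ℓv (w N)⁻¹];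
        let x : ℕ → Fin 2 → ℂ := fun N => x' N ∘ s;
        let y : ℕ → Fin 2 → ℂ := fun N =>
          (![Complex.exp (ℓu (w N)⁻¹), Complex.exp (ℓv (w N)⁻¹)] : Fin 2 → ℂ) ∘ s;
        0 < e → 0 < ρ → AnalyticAt ℂ g 0 → g 0 = 0 → AnalyticAt ℂ ℓu 0 → AnalyticAt ℂ ℓv 0 →
        (¬ ∃ P : MvPolynomial (Fin 2) ℂ, P ≠ 0 ∧
            ∀ᶠ z in 𝓝 (0 : ℂ), MvPolynomial.eval ![z, g z] P = 0) →
        (∀ σ : ℂ, 0 < ‖σ‖ → ‖σ‖ < ρ →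
          Sum.elim ((![2 * ↑π * I * σ⁻¹ ^ e + ℓu σ,
                        2 * ↑π * I * (A.eval σ⁻¹ + g σ) + ℓv σ] : Fin 2 → ℂ) ∘ s)
            ((![Complex.exp (ℓu σ), Complex.exp (ℓv σ)] : Fin 2 → ℂ) ∘ s) ∈ W) →
        (¬ ∃ (q : Polynomial ℚ) (c : ℂ), ∀ N : ℕ,
            A.eval (w N) = (q.map (algebraMap ℚ ℂ)).eval (N : ℂ) + c) →
        ((∀ k : ℕ, (A.coeff k).im = 0) ∧ ∀ᶠ t : ℝ in 𝓝[>] 0, (g (t : ℂ)).im = 0) →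
        0 < r → AnalyticAt ℂ T 0 → T 0 = 0 → AnalyticAt ℂ ℓ₀ 0 → AnalyticAt ℂ ℓ₁ 0 → AnalyticAt ℂ Φ₁ 0 →
        (∀ t : ℂ, 0 < ‖t‖ → ‖t‖ < r →
          Sum.elim ((![(t ^ e)⁻¹, Φ₁ t / t ^ N₀] : Fin 2 → ℂ) ∘ s)
            ((![Complex.exp (ℓ₀ t), Complex.exp (ℓ₁ t)] : Fin 2 → ℂ) ∘ s) ∈ W) →
        (∀ σ : ℂ, 0 < ‖σ‖ → ‖σ‖ < ρ → 0 < ‖T σ‖ ∧ ‖T σ‖ < r ∧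
          ((T σ) ^ e)⁻¹ = 2 * ↑π * I * σ⁻¹ ^ e + ℓu σ ∧
          Φ₁ (T σ) / (T σ) ^ N₀ = 2 * ↑π * I * (A.eval σ⁻¹ + g σ) + ℓv σ ∧
          ℓ₀ (T σ) = ℓu σ ∧ ℓ₁ (T σ) = ℓv σ) →
        (∀ (e q : ℕ) (m₁ : ℤ) (β : ℂ) (Φ : ℂ → ℂ) (t c : ℕ → ℂ) (lam : ℂ),
          0 < e → 0 < q → β.im = 0 → IsAlgebraic ℚ β →
          AnalyticAt ℂ Φ 0 → Φ 0 = 0 → (¬ ∀ᶠ z in 𝓝 (0 : ℂ), Φ z = 0) →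
          (∀ n : ℕ, IsAlgebraic ℚ (iteratedDeriv n Φ 0)) →
          (∀ j : ℕ, j < e * ((minpoly ℚ β).natDegree - 1) → iteratedDeriv j Φ 0 = 0) →
          Tendsto t atTop (𝓝 0) → Tendsto c atTop (𝓝 lam) →
          (∀ᶠ n : ℕ in atTop, t n ≠ 0 ∧ ((t n) ^ e)⁻¹ = 2 * ↑π * I * (n : ℂ) + c n) →
          Set.Finite {n : ℕ | ∃ L : ℤ,
            β * ((q : ℂ) * (n : ℂ) + (m₁ : ℂ)) + (q : ℂ) * Φ (t n) / (2 * ↑π * I) = L}) →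
        ((∃ W' : Set (Fin 2 ⊕ Fin 2 → ℂ), IsDefinedOver (⊥ : Subfield ℂ) W' ∧ zariskiDim ℂ W' < 2 ∧
            ∀ t : ℂ, 0 < ‖t‖ → ‖t‖ < r →
              Sum.elim (![(t ^ e)⁻¹, Φ₁ t / t ^ N₀] : Fin 2 → ℂ)
                (![Complex.exp (ℓ₀ t), Complex.exp (ℓ₁ t)] : Fin 2 → ℂ) ∈ W') →
          (∃ R : MvPolynomial (Fin 2) ℚ, R ≠ 0 ∧ ∀ t : ℂ, 0 < ‖t‖ → ‖t‖ < r →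
            MvPolynomial.aeval ![(t ^ e)⁻¹, Complex.exp (ℓ₀ t)] R = 0) →
          (∃ R : MvPolynomial (Fin 2) ℚ, R ≠ 0 ∧ ∀ t : ℂ, 0 < ‖t‖ → ‖t‖ < r →
            MvPolynomial.aeval ![(t ^ e)⁻¹, Complex.exp (ℓ₁ t)] R = 0) →
          (∃ R : MvPolynomial (Fin 2) ℚ, R ≠ 0 ∧ ∀ t : ℂ, 0 < ‖t‖ → ‖t‖ < r →
            MvPolynomial.aeval ![(t ^ e)⁻¹, Φ₁ t / t ^ N₀] R = 0) →
          (∃ R : MvPolynomial (Fin 2) ℚ, R ≠ 0 ∧ ∀ t : ℂ, 0 < ‖t‖ → ‖t‖ < r →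
            MvPolynomial.aeval ![Φ₁ t / t ^ N₀, Complex.exp (ℓ₀ t)] R = 0) →
          (∃ R : MvPolynomial (Fin 2) ℚ, R ≠ 0 ∧ ∀ t : ℂ, 0 < ‖t‖ → ‖t‖ < r →
            MvPolynomial.aeval ![Φ₁ t / t ^ N₀, Complex.exp (ℓ₁ t)] R = 0) →
          (∃ R : MvPolynomial (Fin 2) ℚ, R ≠ 0 ∧ ∀ t : ℂ, 0 < ‖t‖ → ‖t‖ < r →
            MvPolynomial.aeval ![Complex.exp (ℓ₀ t), Complex.exp (ℓ₁ t)] R = 0) →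
          (∀ n : ℕ, IsAlgebraic ℚ (iteratedDeriv n Φ₁ 0)) →
          IsAlgebraic ℚ (Complex.exp (ℓ₀ 0)) → IsAlgebraic ℚ (Complex.exp (ℓ₁ 0)) →
          (∀ n : ℕ, 0 < n → IsAlgebraic ℚ (iteratedDeriv n ℓ₀ 0)) →
          (∀ n : ℕ, 0 < n → IsAlgebraic ℚ (iteratedDeriv n ℓ₁ 0)) →
          (¬ ∃ (β : ℂ) (G : ℂ → ℂ), AnalyticAt ℂ G 0 ∧
              ∀ t : ℂ, 0 < ‖t‖ → ‖t‖ < r → Φ₁ t / t ^ N₀ = β * (t ^ e)⁻¹ + G t) →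
          (¬ ∀ᶠ t in 𝓝 (0 : ℂ), ℓ₀ t = ℓ₀ 0 ∧ ℓ₁ t = ℓ₁ 0) →
          Set.Finite {n : ℕ | LinearIndependent ℚ (x' n) ∧ ∃ L : ℤ, A.eval (w n) + g (w n)⁻¹ = L}) →
        (∀ (G : ℂ → ℂ) (β : ℂ),
          (∃ W' : Set (Fin 2 ⊕ Fin 2 → ℂ), IsDefinedOver (⊥ : Subfield ℂ) W' ∧ zariskiDim ℂ W' < 2 ∧
            ∀ t : ℂ, 0 < ‖t‖ → ‖t‖ < r →
              Sum.elim (![(t ^ e)⁻¹, Φ₁ t / t ^ N₀] : Fin 2 → ℂ)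
                (![Complex.exp (ℓ₀ t), Complex.exp (ℓ₁ t)] : Fin 2 → ℂ) ∈ W') →
          (∃ R : MvPolynomial (Fin 2) ℚ, R ≠ 0 ∧ ∀ t : ℂ, 0 < ‖t‖ → ‖t‖ < r →
            MvPolynomial.aeval ![(t ^ e)⁻¹, Complex.exp (ℓ₀ t)] R = 0) →
          (∃ R : MvPolynomial (Fin 2) ℚ, R ≠ 0 ∧ ∀ t : ℂ, 0 < ‖t‖ → ‖t‖ < r →
            MvPolynomial.aeval ![(t ^ e)⁻¹, Complex.exp (ℓ₁ t)] R = 0) →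
          (∃ R : MvPolynomial (Fin 2) ℚ, R ≠ 0 ∧ ∀ t : ℂ, 0 < ‖t‖ → ‖t‖ < r →
            MvPolynomial.aeval ![(t ^ e)⁻¹, Φ₁ t / t ^ N₀] R = 0) →
          (∃ R : MvPolynomial (Fin 2) ℚ, R ≠ 0 ∧ ∀ t : ℂ, 0 < ‖t‖ → ‖t‖ < r →
            MvPolynomial.aeval ![Φ₁ t / t ^ N₀, Complex.exp (ℓ₀ t)] R = 0) →
          (∃ R : MvPolynomial (Fin 2) ℚ, R ≠ 0 ∧ ∀ t : ℂ, 0 < ‖t‖ → ‖t‖ < r →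
            MvPolynomial.aeval ![Φ₁ t / t ^ N₀, Complex.exp (ℓ₁ t)] R = 0) →
          (∃ R : MvPolynomial (Fin 2) ℚ, R ≠ 0 ∧ ∀ t : ℂ, 0 < ‖t‖ → ‖t‖ < r →
            MvPolynomial.aeval ![Complex.exp (ℓ₀ t), Complex.exp (ℓ₁ t)] R = 0) →
          (∀ n : ℕ, IsAlgebraic ℚ (iteratedDeriv n Φ₁ 0)) →
          IsAlgebraic ℚ (Complex.exp (ℓ₀ 0)) → IsAlgebraic ℚ (Complex.exp (ℓ₁ 0)) →
          (∀ n : ℕ, 0 < n → IsAlgebraic ℚ (iteratedDeriv n ℓ₀ 0)) →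
          (∀ n : ℕ, 0 < n → IsAlgebraic ℚ (iteratedDeriv n ℓ₁ 0)) →
          AnalyticAt ℂ G 0 → (∀ t : ℂ, 0 < ‖t‖ → ‖t‖ < r → Φ₁ t / t ^ N₀ = β * (t ^ e)⁻¹ + G t) →
          IsAlgebraic ℚ β → (∀ n : ℕ, IsAlgebraic ℚ (iteratedDeriv n G 0)) →
          (∀ r' : ℚ, (r' : ℂ) ≠ β) →
          (¬ ∀ᶠ t in 𝓝 (0 : ℂ), ℓ₀ t = ℓ₀ 0 ∧ ℓ₁ t = ℓ₁ 0) →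
          ((∃ q : ℕ, 0 < q ∧ Complex.exp (ℓ₀ 0) ^ q = 1 ∧ Complex.exp (ℓ₁ 0) ^ q = 1) → G 0 ≠ 0) →
          Set.Finite {n : ℕ | LinearIndependent ℚ (x' n) ∧ ∃ L : ℤ, A.eval (w n) + g (w n)⁻¹ = L}) →
        (∀ (G : ℂ → ℂ) (β : ℂ) (q : ℕ) (m₀ m₁ : ℤ),
          (∃ W' : Set (Fin 2 ⊕ Fin 2 → ℂ), IsDefinedOver (⊥ : Subfield ℂ) W' ∧ zariskiDim ℂ W' < 2 ∧
            ∀ t : ℂ, 0 < ‖t‖ → ‖t‖ < r →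
              Sum.elim (![(t ^ e)⁻¹, Φ₁ t / t ^ N₀] : Fin 2 → ℂ)
                (![Complex.exp (ℓ₀ t), Complex.exp (ℓ₁ t)] : Fin 2 → ℂ) ∈ W') →
          (∃ R : MvPolynomial (Fin 2) ℚ, R ≠ 0 ∧ ∀ t : ℂ, 0 < ‖t‖ → ‖t‖ < r →
            MvPolynomial.aeval ![(t ^ e)⁻¹, Complex.exp (ℓ₀ t)] R = 0) →
          (∃ R : MvPolynomial (Fin 2) ℚ, R ≠ 0 ∧ ∀ t : ℂ, 0 < ‖t‖ → ‖t‖ < r →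
            MvPolynomial.aeval ![(t ^ e)⁻¹, Complex.exp (ℓ₁ t)] R = 0) →
          (∃ R : MvPolynomial (Fin 2) ℚ, R ≠ 0 ∧ ∀ t : ℂ, 0 < ‖t‖ → ‖t‖ < r →
            MvPolynomial.aeval ![(t ^ e)⁻¹, Φ₁ t / t ^ N₀] R = 0) →
          (∃ R : MvPolynomial (Fin 2) ℚ, R ≠ 0 ∧ ∀ t : ℂ, 0 < ‖t‖ → ‖t‖ < r →
            MvPolynomial.aeval ![Φ₁ t / t ^ N₀, Complex.exp (ℓ₀ t)] R = 0) →
          (∃ R : MvPolynomial (Fin 2) ℚ, R ≠ 0 ∧ ∀ t : ℂ, 0 < ‖t‖ → ‖t‖ < r →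
            MvPolynomial.aeval ![Φ₁ t / t ^ N₀, Complex.exp (ℓ₁ t)] R = 0) →
          (∃ R : MvPolynomial (Fin 2) ℚ, R ≠ 0 ∧ ∀ t : ℂ, 0 < ‖t‖ → ‖t‖ < r →
            MvPolynomial.aeval ![Complex.exp (ℓ₀ t), Complex.exp (ℓ₁ t)] R = 0) →
          (∀ n : ℕ, IsAlgebraic ℚ (iteratedDeriv n Φ₁ 0)) →
          IsAlgebraic ℚ (Complex.exp (ℓ₀ 0)) → IsAlgebraic ℚ (Complex.exp (ℓ₁ 0)) →
          (∀ n : ℕ, 0 < n → IsAlgebraic ℚ (iteratedDeriv n ℓ₀ 0)) →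
          (∀ n : ℕ, 0 < n → IsAlgebraic ℚ (iteratedDeriv n ℓ₁ 0)) →
          AnalyticAt ℂ G 0 → (∀ t : ℂ, 0 < ‖t‖ → ‖t‖ < r → Φ₁ t / t ^ N₀ = β * (t ^ e)⁻¹ + G t) →
          IsAlgebraic ℚ β → (∀ n : ℕ, IsAlgebraic ℚ (iteratedDeriv n G 0)) →
          (∀ r' : ℚ, (r' : ℂ) ≠ β) →
          β.im = 0 → 0 < q → (q : ℂ) * ℓ₀ 0 = 2 * ↑π * I * (m₀ : ℂ) → (q : ℂ) * ℓ₁ 0 = 2 * ↑π * I * (m₁ : ℂ) →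
          G 0 = 0 →
          (¬ ∀ᶠ t in 𝓝 (0 : ℂ), ℓ₀ t = ℓ₀ 0 ∧ ℓ₁ t = ℓ₁ 0) →
          (∃ j : ℕ, j ≤ e ∧ j < e * ((minpoly ℚ β).natDegree - 1) ∧
            (∀ i : ℕ, i < j → iteratedDeriv i (fun t => β * (ℓ₀ t - ℓ₀ 0) - (ℓ₁ t - ℓ₁ 0) + G t) 0 = 0) ∧
            iteratedDeriv j (fun t => β * (ℓ₀ t - ℓ₀ 0) - (ℓ₁ t - ℓ₁ 0) + G t) 0 ≠ 0) →
          Set.Finite {n : ℕ | LinearIndependent ℚ (x' n) ∧ ∃ L : ℤ, A.eval (w n) + g (w n)⁻¹ = L}) →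
        Set.Finite {N : ℕ | x N ∈ indepExpPoints W ∧ Complex.exp ∘ x N = y N ∧
          ∃ L : ℤ, A.eval (w N) + g (w N)⁻¹ = L}) →
    (∀ (W : Set (Fin 2 ⊕ Fin 2 → ℂ)), IsDefinedOver (⊥ : Subfield ℂ) W → zariskiDim ℂ W < 2 →
        (indepExpPoints W).Infinite →
        (∃ (s : Fin 2 ≃ Fin 2) (e : ℕ) (A : Polynomial ℂ) (g ℓu ℓv : ℂ → ℂ) (ρ : ℝ)
            (N₀ : ℕ) (T ℓ₀ ℓ₁ Φ₁ : ℂ → ℂ) (r : ℝ),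
          let w : ℕ → ℂ := fun N => (((N : ℝ) ^ ((e : ℝ)⁻¹) : ℝ) : ℂ);
          let x : ℕ → Fin 2 → ℂ := fun N =>
            (![2 * ↑π * I * (N : ℂ) + ℓu (w N)⁻¹,
                2 * ↑π * I * (A.eval (w N) + g (w N)⁻¹) + ℓv (w N)⁻¹] : Fin 2 → ℂ) ∘ s;
          let y : ℕ → Fin 2 → ℂ := fun N =>
            (![Complex.exp (ℓu (w N)⁻¹), Complex.exp (ℓv (w N)⁻¹)] : Fin 2 → ℂ) ∘ s;
          (0 < e ∧ 0 < ρ ∧ AnalyticAt ℂ g 0 ∧ g 0 = 0 ∧ AnalyticAt ℂ ℓu 0 ∧ AnalyticAt ℂ ℓv 0 ∧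
          (¬ ∃ P : MvPolynomial (Fin 2) ℂ, P ≠ 0 ∧
              ∀ᶠ z in 𝓝 (0 : ℂ), MvPolynomial.eval ![z, g z] P = 0) ∧
          (∀ σ : ℂ, 0 < ‖σ‖ → ‖σ‖ < ρ →
            Sum.elim ((![2 * ↑π * I * σ⁻¹ ^ e + ℓu σ,
                          2 * ↑π * I * (A.eval σ⁻¹ + g σ) + ℓv σ] : Fin 2 → ℂ) ∘ s)
              ((![Complex.exp (ℓu σ), Complex.exp (ℓv σ)] : Fin 2 → ℂ) ∘ s) ∈ W) ∧
          Set.Infinite {N : ℕ | x N ∈ indepExpPoints W ∧ Complex.exp ∘ x N = y N ∧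
            ∃ L : ℤ, A.eval (w N) + g (w N)⁻¹ = L}) ∧
          (0 < r ∧ AnalyticAt ℂ T 0 ∧ T 0 = 0 ∧ AnalyticAt ℂ ℓ₀ 0 ∧ AnalyticAt ℂ ℓ₁ 0 ∧ AnalyticAt ℂ Φ₁ 0 ∧
          (∀ t : ℂ, 0 < ‖t‖ → ‖t‖ < r →
            Sum.elim ((![(t ^ e)⁻¹, Φ₁ t / t ^ N₀] : Fin 2 → ℂ) ∘ s)
              ((![Complex.exp (ℓ₀ t), Complex.exp (ℓ₁ t)] : Fin 2 → ℂ) ∘ s) ∈ W) ∧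
          (∀ σ : ℂ, 0 < ‖σ‖ → ‖σ‖ < ρ → 0 < ‖T σ‖ ∧ ‖T σ‖ < r ∧
            ((T σ) ^ e)⁻¹ = 2 * ↑π * I * σ⁻¹ ^ e + ℓu σ ∧
            Φ₁ (T σ) / (T σ) ^ N₀ = 2 * ↑π * I * (A.eval σ⁻¹ + g σ) + ℓv σ ∧
            ℓ₀ (T σ) = ℓu σ ∧ ℓ₁ (T σ) = ℓv σ))) ∨
        (∃ a b : ℤ, (a ≠ 0 ∨ b ≠ 0) ∧ ∃ c : ℂ,
          Set.Infinite {x : Fin 2 → ℂ | x ∈ indepExpPoints W ∧ (a : ℂ) * x 0 + (b : ℂ) * x 1 = c}) ∨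
        (∃ ω : Fin 2 → ℂ,
          Set.Infinite {x : Fin 2 → ℂ | x ∈ indepExpPoints W ∧ Complex.exp ∘ x = ω})) →
    (∀ (e q : ℕ) (m₁ : ℤ) (β : ℂ) (Φ : ℂ → ℂ) (t c : ℕ → ℂ) (lam : ℂ),
        0 < e → 0 < q → β.im = 0 → IsAlgebraic ℚ β →
        AnalyticAt ℂ Φ 0 → Φ 0 = 0 → (¬ ∀ᶠ z in 𝓝 (0 : ℂ), Φ z = 0) →
        (∀ n : ℕ, IsAlgebraic ℚ (iteratedDeriv n Φ 0)) →
        (∀ j : ℕ, j < e * ((minpoly ℚ β).natDegree - 1) → iteratedDeriv j Φ 0 = 0) →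
        Tendsto t atTop (𝓝 0) → Tendsto c atTop (𝓝 lam) →
        (∀ᶠ n : ℕ in atTop, t n ≠ 0 ∧ ((t n) ^ e)⁻¹ = 2 * ↑π * I * (n : ℂ) + c n) →
        Set.Finite {n : ℕ | ∃ L : ℤ,
          β * ((q : ℂ) * (n : ℂ) + (m₁ : ℂ)) + (q : ℂ) * Φ (t n) / (2 * ↑π * I) = L}) →
    (∀ (e N₀ : ℕ) (A : Polynomial ℂ) (g ℓu ℓv T ℓ₀ ℓ₁ Φ₁ : ℂ → ℂ) (ρ r : ℝ),
        let w : ℕ → ℂ := fun n => (((n : ℝ) ^ ((e : ℝ)⁻¹) : ℝ) : ℂ);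
        let x : ℕ → Fin 2 → ℂ := fun n =>
          ![2 * ↑π * I * (n : ℂ) + ℓu (w n)⁻¹, 2 * ↑π * I * (A.eval (w n) + g (w n)⁻¹) + ℓv (w n)⁻¹];
        0 < e → 0 < ρ → 0 < r → AnalyticAt ℂ g 0 → g 0 = 0 → AnalyticAt ℂ ℓu 0 → AnalyticAt ℂ ℓv 0 →
        AnalyticAt ℂ T 0 → T 0 = 0 → AnalyticAt ℂ ℓ₀ 0 → AnalyticAt ℂ ℓ₁ 0 → AnalyticAt ℂ Φ₁ 0 →
        (¬ ∃ P : MvPolynomial (Fin 2) ℂ, P ≠ 0 ∧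
            ∀ᶠ z in 𝓝 (0 : ℂ), MvPolynomial.eval ![z, g z] P = 0) →
        (¬ ∃ (q : Polynomial ℚ) (c : ℂ), ∀ N : ℕ,
            A.eval (w N) = (q.map (algebraMap ℚ ℂ)).eval (N : ℂ) + c) →
        ((∀ k : ℕ, (A.coeff k).im = 0) ∧ ∀ᶠ u : ℝ in 𝓝[>] 0, (g (u : ℂ)).im = 0) →
        (∀ ε : ℝ, 0 < ε → ∃ᶠ X : ℕ in atTop,
          (Nat.card {N : ℕ | N ≤ X ∧ ∃ L : ℤ, A.eval (w N) + g (w N)⁻¹ = L} : ℝ) ≤ ε * Real.log X) →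
        (∀ σ : ℂ, 0 < ‖σ‖ → ‖σ‖ < ρ → 0 < ‖T σ‖ ∧ ‖T σ‖ < r ∧
          ((T σ) ^ e)⁻¹ = 2 * ↑π * I * σ⁻¹ ^ e + ℓu σ ∧
          Φ₁ (T σ) / (T σ) ^ N₀ = 2 * ↑π * I * (A.eval σ⁻¹ + g σ) + ℓv σ ∧
          ℓ₀ (T σ) = ℓu σ ∧ ℓ₁ (T σ) = ℓv σ) →
        (∃ W' : Set (Fin 2 ⊕ Fin 2 → ℂ), IsDefinedOver (⊥ : Subfield ℂ) W' ∧ zariskiDim ℂ W' < 2 ∧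
          ∀ t : ℂ, 0 < ‖t‖ → ‖t‖ < r →
            Sum.elim (![(t ^ e)⁻¹, Φ₁ t / t ^ N₀] : Fin 2 → ℂ)
              (![Complex.exp (ℓ₀ t), Complex.exp (ℓ₁ t)] : Fin 2 → ℂ) ∈ W') →
        (∃ R : MvPolynomial (Fin 2) ℚ, R ≠ 0 ∧ ∀ t : ℂ, 0 < ‖t‖ → ‖t‖ < r →
          MvPolynomial.aeval ![(t ^ e)⁻¹, Complex.exp (ℓ₀ t)] R = 0) →
        (∃ R : MvPolynomial (Fin 2) ℚ, R ≠ 0 ∧ ∀ t : ℂ, 0 < ‖t‖ → ‖t‖ < r →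
          MvPolynomial.aeval ![(t ^ e)⁻¹, Complex.exp (ℓ₁ t)] R = 0) →
        (∃ R : MvPolynomial (Fin 2) ℚ, R ≠ 0 ∧ ∀ t : ℂ, 0 < ‖t‖ → ‖t‖ < r →
          MvPolynomial.aeval ![(t ^ e)⁻¹, Φ₁ t / t ^ N₀] R = 0) →
        (∃ R : MvPolynomial (Fin 2) ℚ, R ≠ 0 ∧ ∀ t : ℂ, 0 < ‖t‖ → ‖t‖ < r →
          MvPolynomial.aeval ![Φ₁ t / t ^ N₀, Complex.exp (ℓ₀ t)] R = 0) →
        (∃ R : MvPolynomial (Fin 2) ℚ, R ≠ 0 ∧ ∀ t : ℂ, 0 < ‖t‖ → ‖t‖ < r →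
          MvPolynomial.aeval ![Φ₁ t / t ^ N₀, Complex.exp (ℓ₁ t)] R = 0) →
        (∃ R : MvPolynomial (Fin 2) ℚ, R ≠ 0 ∧ ∀ t : ℂ, 0 < ‖t‖ → ‖t‖ < r →
          MvPolynomial.aeval ![Complex.exp (ℓ₀ t), Complex.exp (ℓ₁ t)] R = 0) →
        (∀ n : ℕ, IsAlgebraic ℚ (iteratedDeriv n Φ₁ 0)) →
        IsAlgebraic ℚ (Complex.exp (ℓ₀ 0)) → IsAlgebraic ℚ (Complex.exp (ℓ₁ 0)) →
        (∀ n : ℕ, 0 < n → IsAlgebraic ℚ (iteratedDeriv n ℓ₀ 0)) →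
        (∀ n : ℕ, 0 < n → IsAlgebraic ℚ (iteratedDeriv n ℓ₁ 0)) →
        (¬ ∃ (β : ℂ) (G : ℂ → ℂ), AnalyticAt ℂ G 0 ∧
            ∀ t : ℂ, 0 < ‖t‖ → ‖t‖ < r → Φ₁ t / t ^ N₀ = β * (t ^ e)⁻¹ + G t) →
        (¬ ∀ᶠ t in 𝓝 (0 : ℂ), ℓ₀ t = ℓ₀ 0 ∧ ℓ₁ t = ℓ₁ 0) →
        Set.Finite {n : ℕ | LinearIndependent ℚ (x n) ∧ ∃ L : ℤ, A.eval (w n) + g (w n)⁻¹ = L}) →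
    (∀ (e N₀ : ℕ) (A : Polynomial ℂ) (g ℓu ℓv T ℓ₀ ℓ₁ Φ₁ G : ℂ → ℂ) (ρ r : ℝ) (β : ℂ),
        let w : ℕ → ℂ := fun n => (((n : ℝ) ^ ((e : ℝ)⁻¹) : ℝ) : ℂ);
        let x : ℕ → Fin 2 → ℂ := fun n =>
          ![2 * ↑π * I * (n : ℂ) + ℓu (w n)⁻¹, 2 * ↑π * I * (A.eval (w n) + g (w n)⁻¹) + ℓv (w n)⁻¹];
        0 < e → 0 < ρ → 0 < r → AnalyticAt ℂ g 0 → g 0 = 0 → AnalyticAt ℂ ℓu 0 → AnalyticAt ℂ ℓv 0 →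
        AnalyticAt ℂ T 0 → T 0 = 0 → AnalyticAt ℂ ℓ₀ 0 → AnalyticAt ℂ ℓ₁ 0 → AnalyticAt ℂ Φ₁ 0 →
        (¬ ∃ P : MvPolynomial (Fin 2) ℂ, P ≠ 0 ∧
            ∀ᶠ z in 𝓝 (0 : ℂ), MvPolynomial.eval ![z, g z] P = 0) →
        (¬ ∃ (q : Polynomial ℚ) (c : ℂ), ∀ N : ℕ,
            A.eval (w N) = (q.map (algebraMap ℚ ℂ)).eval (N : ℂ) + c) →
        ((∀ k : ℕ, (A.coeff k).im = 0) ∧ ∀ᶠ u : ℝ in 𝓝[>] 0, (g (u : ℂ)).im = 0) →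
        (∀ ε : ℝ, 0 < ε → ∃ᶠ X : ℕ in atTop,
          (Nat.card {N : ℕ | N ≤ X ∧ ∃ L : ℤ, A.eval (w N) + g (w N)⁻¹ = L} : ℝ) ≤ ε * Real.log X) →
        (∀ σ : ℂ, 0 < ‖σ‖ → ‖σ‖ < ρ → 0 < ‖T σ‖ ∧ ‖T σ‖ < r ∧
          ((T σ) ^ e)⁻¹ = 2 * ↑π * I * σ⁻¹ ^ e + ℓu σ ∧
          Φ₁ (T σ) / (T σ) ^ N₀ = 2 * ↑π * I * (A.eval σ⁻¹ + g σ) + ℓv σ ∧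
          ℓ₀ (T σ) = ℓu σ ∧ ℓ₁ (T σ) = ℓv σ) →
        (∃ W' : Set (Fin 2 ⊕ Fin 2 → ℂ), IsDefinedOver (⊥ : Subfield ℂ) W' ∧ zariskiDim ℂ W' < 2 ∧
          ∀ t : ℂ, 0 < ‖t‖ → ‖t‖ < r →
            Sum.elim (![(t ^ e)⁻¹, Φ₁ t / t ^ N₀] : Fin 2 → ℂ)
              (![Complex.exp (ℓ₀ t), Complex.exp (ℓ₁ t)] : Fin 2 → ℂ) ∈ W') →
        (∃ R : MvPolynomial (Fin 2) ℚ, R ≠ 0 ∧ ∀ t : ℂ, 0 < ‖t‖ → ‖t‖ < r →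
          MvPolynomial.aeval ![(t ^ e)⁻¹, Complex.exp (ℓ₀ t)] R = 0) →
        (∃ R : MvPolynomial (Fin 2) ℚ, R ≠ 0 ∧ ∀ t : ℂ, 0 < ‖t‖ → ‖t‖ < r →
          MvPolynomial.aeval ![(t ^ e)⁻¹, Complex.exp (ℓ₁ t)] R = 0) →
        (∃ R : MvPolynomial (Fin 2) ℚ, R ≠ 0 ∧ ∀ t : ℂ, 0 < ‖t‖ → ‖t‖ < r →
          MvPolynomial.aeval ![(t ^ e)⁻¹, Φ₁ t / t ^ N₀] R = 0) →
        (∃ R : MvPolynomial (Fin 2) ℚ, R ≠ 0 ∧ ∀ t : ℂ, 0 < ‖t‖ → ‖t‖ < r →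
          MvPolynomial.aeval ![Φ₁ t / t ^ N₀, Complex.exp (ℓ₀ t)] R = 0) →
        (∃ R : MvPolynomial (Fin 2) ℚ, R ≠ 0 ∧ ∀ t : ℂ, 0 < ‖t‖ → ‖t‖ < r →
          MvPolynomial.aeval ![Φ₁ t / t ^ N₀, Complex.exp (ℓ₁ t)] R = 0) →
        (∃ R : MvPolynomial (Fin 2) ℚ, R ≠ 0 ∧ ∀ t : ℂ, 0 < ‖t‖ → ‖t‖ < r →
          MvPolynomial.aeval ![Complex.exp (ℓ₀ t), Complex.exp (ℓ₁ t)] R = 0) →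
        (∀ n : ℕ, IsAlgebraic ℚ (iteratedDeriv n Φ₁ 0)) →
        IsAlgebraic ℚ (Complex.exp (ℓ₀ 0)) → IsAlgebraic ℚ (Complex.exp (ℓ₁ 0)) →
        (∀ n : ℕ, 0 < n → IsAlgebraic ℚ (iteratedDeriv n ℓ₀ 0)) →
        (∀ n : ℕ, 0 < n → IsAlgebraic ℚ (iteratedDeriv n ℓ₁ 0)) →
        AnalyticAt ℂ G 0 → (∀ t : ℂ, 0 < ‖t‖ → ‖t‖ < r → Φ₁ t / t ^ N₀ = β * (t ^ e)⁻¹ + G t) →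
        IsAlgebraic ℚ β → (∀ n : ℕ, IsAlgebraic ℚ (iteratedDeriv n G 0)) →
        (∀ r' : ℚ, (r' : ℂ) ≠ β) →
        (¬ ∀ᶠ t in 𝓝 (0 : ℂ), ℓ₀ t = ℓ₀ 0 ∧ ℓ₁ t = ℓ₁ 0) →
        ((∃ q : ℕ, 0 < q ∧ Complex.exp (ℓ₀ 0) ^ q = 1 ∧ Complex.exp (ℓ₁ 0) ^ q = 1) → G 0 ≠ 0) →
        Set.Finite {n : ℕ | LinearIndependent ℚ (x n) ∧ ∃ L : ℤ, A.eval (w n) + g (w n)⁻¹ = L}) →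
    (∀ (e N₀ : ℕ) (A : Polynomial ℂ) (g ℓu ℓv T ℓ₀ ℓ₁ Φ₁ G : ℂ → ℂ) (ρ r : ℝ) (β : ℂ) (q : ℕ) (m₀ m₁ : ℤ),
        let w : ℕ → ℂ := fun n => (((n : ℝ) ^ ((e : ℝ)⁻¹) : ℝ) : ℂ);
        let x : ℕ → Fin 2 → ℂ := fun n =>
          ![2 * ↑π * I * (n : ℂ) + ℓu (w n)⁻¹, 2 * ↑π * I * (A.eval (w n) + g (w n)⁻¹) + ℓv (w n)⁻¹];
        0 < e → 0 < ρ → 0 < r → AnalyticAt ℂ g 0 → g 0 = 0 → AnalyticAt ℂ ℓu 0 → AnalyticAt ℂ ℓv 0 →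
        AnalyticAt ℂ T 0 → T 0 = 0 → AnalyticAt ℂ ℓ₀ 0 → AnalyticAt ℂ ℓ₁ 0 → AnalyticAt ℂ Φ₁ 0 →
        (¬ ∃ P : MvPolynomial (Fin 2) ℂ, P ≠ 0 ∧
            ∀ᶠ z in 𝓝 (0 : ℂ), MvPolynomial.eval ![z, g z] P = 0) →
        (¬ ∃ (q : Polynomial ℚ) (c : ℂ), ∀ N : ℕ,
            A.eval (w N) = (q.map (algebraMap ℚ ℂ)).eval (N : ℂ) + c) →
        ((∀ k : ℕ, (A.coeff k).im = 0) ∧ ∀ᶠ u : ℝ in 𝓝[>] 0, (g (u : ℂ)).im = 0) →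
        (∀ ε : ℝ, 0 < ε → ∃ᶠ X : ℕ in atTop,
          (Nat.card {N : ℕ | N ≤ X ∧ ∃ L : ℤ, A.eval (w N) + g (w N)⁻¹ = L} : ℝ) ≤ ε * Real.log X) →
        (∀ σ : ℂ, 0 < ‖σ‖ → ‖σ‖ < ρ → 0 < ‖T σ‖ ∧ ‖T σ‖ < r ∧
          ((T σ) ^ e)⁻¹ = 2 * ↑π * I * σ⁻¹ ^ e + ℓu σ ∧
          Φ₁ (T σ) / (T σ) ^ N₀ = 2 * ↑π * I * (A.eval σ⁻¹ + g σ) + ℓv σ ∧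
          ℓ₀ (T σ) = ℓu σ ∧ ℓ₁ (T σ) = ℓv σ) →
        (∃ W' : Set (Fin 2 ⊕ Fin 2 → ℂ), IsDefinedOver (⊥ : Subfield ℂ) W' ∧ zariskiDim ℂ W' < 2 ∧
          ∀ t : ℂ, 0 < ‖t‖ → ‖t‖ < r →
            Sum.elim (![(t ^ e)⁻¹, Φ₁ t / t ^ N₀] : Fin 2 → ℂ)
              (![Complex.exp (ℓ₀ t), Complex.exp (ℓ₁ t)] : Fin 2 → ℂ) ∈ W') →
        (∃ R : MvPolynomial (Fin 2) ℚ, R ≠ 0 ∧ ∀ t : ℂ, 0 < ‖t‖ → ‖t‖ < r →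
          MvPolynomial.aeval ![(t ^ e)⁻¹, Complex.exp (ℓ₀ t)] R = 0) →
        (∃ R : MvPolynomial (Fin 2) ℚ, R ≠ 0 ∧ ∀ t : ℂ, 0 < ‖t‖ → ‖t‖ < r →
          MvPolynomial.aeval ![(t ^ e)⁻¹, Complex.exp (ℓ₁ t)] R = 0) →
        (∃ R : MvPolynomial (Fin 2) ℚ, R ≠ 0 ∧ ∀ t : ℂ, 0 < ‖t‖ → ‖t‖ < r →
          MvPolynomial.aeval ![(t ^ e)⁻¹, Φ₁ t / t ^ N₀] R = 0) →
        (∃ R : MvPolynomial (Fin 2) ℚ, R ≠ 0 ∧ ∀ t : ℂ, 0 < ‖t‖ → ‖t‖ < r →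
          MvPolynomial.aeval ![Φ₁ t / t ^ N₀, Complex.exp (ℓ₀ t)] R = 0) →
        (∃ R : MvPolynomial (Fin 2) ℚ, R ≠ 0 ∧ ∀ t : ℂ, 0 < ‖t‖ → ‖t‖ < r →
          MvPolynomial.aeval ![Φ₁ t / t ^ N₀, Complex.exp (ℓ₁ t)] R = 0) →
        (∃ R : MvPolynomial (Fin 2) ℚ, R ≠ 0 ∧ ∀ t : ℂ, 0 < ‖t‖ → ‖t‖ < r →
          MvPolynomial.aeval ![Complex.exp (ℓ₀ t), Complex.exp (ℓ₁ t)] R = 0) →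
        (∀ n : ℕ, IsAlgebraic ℚ (iteratedDeriv n Φ₁ 0)) →
        IsAlgebraic ℚ (Complex.exp (ℓ₀ 0)) → IsAlgebraic ℚ (Complex.exp (ℓ₁ 0)) →
        (∀ n : ℕ, 0 < n → IsAlgebraic ℚ (iteratedDeriv n ℓ₀ 0)) →
        (∀ n : ℕ, 0 < n → IsAlgebraic ℚ (iteratedDeriv n ℓ₁ 0)) →
        AnalyticAt ℂ G 0 → (∀ t : ℂ, 0 < ‖t‖ → ‖t‖ < r → Φ₁ t / t ^ N₀ = β * (t ^ e)⁻¹ + G t) →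
        IsAlgebraic ℚ β → (∀ n : ℕ, IsAlgebraic ℚ (iteratedDeriv n G 0)) →
        (∀ r' : ℚ, (r' : ℂ) ≠ β) →
        β.im = 0 → 0 < q → (q : ℂ) * ℓ₀ 0 = 2 * ↑π * I * (m₀ : ℂ) → (q : ℂ) * ℓ₁ 0 = 2 * ↑π * I * (m₁ : ℂ) →
        G 0 = 0 →
        (¬ ∀ᶠ t in 𝓝 (0 : ℂ), ℓ₀ t = ℓ₀ 0 ∧ ℓ₁ t = ℓ₁ 0) →
        (∃ j : ℕ, j ≤ e ∧ j < e * ((minpoly ℚ β).natDegree - 1) ∧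
          (∀ i : ℕ, i < j → iteratedDeriv i (fun t => β * (ℓ₀ t - ℓ₀ 0) - (ℓ₁ t - ℓ₁ 0) + G t) 0 = 0) ∧
          iteratedDeriv j (fun t => β * (ℓ₀ t - ℓ₀ 0) - (ℓ₁ t - ℓ₁ 0) + G t) 0 ≠ 0) →
        Set.Finite {n : ℕ | LinearIndependent ℚ (x n) ∧ ∃ L : ℤ, A.eval (w n) + g (w n)⁻¹ = L}) →
    Summit.Schanuel.Schanuel.Theses.RigidCore.SparsityTwo := by
  intro hRunge hSplit hE hDeep hA3 hA2 hA1 W hW hdim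
  by_contra hinf
  change ¬ (indepExpPoints W).Finite at hinf
  rcases hE W hW hdim hinf with
    ⟨s, e, A, g, ℓu, ℓv, ρ, N₀, T, ℓ₀, ℓ₁, Φ₁, r, h, h'⟩ | ⟨a, b, hab, c, hinf'⟩ | ⟨ω, hinf'⟩
  · -- (1) a normalised log-free cusp ray with transcendental tail, infinitely many ray hits, and its
    -- algebraic uniformisation
    obtain ⟨he, hρ, hg, hg0, hu, hv, htr, hbr, hray⟩ := h
    obtain ⟨hr, hT, hT0, h₀, h₁, hΦ₁, hbr', hlink⟩ := h'
    by_cases hrat : ∃ (q : Polynomial ℚ) (c : ℂ), ∀ N : ℕ,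
        A.eval ((((N : ℝ) ^ ((e : ℝ)⁻¹) : ℝ) : ℂ)) = (q.map (algebraMap ℚ ℂ)).eval (N : ℂ) + c
    · -- rational jet up to a constant: the shifted Runge lemma forces `g ≡ 0` near `0`,
      -- contradicting transcendence (`P = X₁`)
      obtain ⟨q, c, hq⟩ := hrat
      have hz : ∀ᶠ z in 𝓝 (0 : ℂ), g z = 0 :=
        tail_eventually_zero_of_ratJet_rayHits hRunge e A g q c _ he hg hg0 hq hray fun N hN => hN.2.2
      exact htr ⟨MvPolynomial.X 1, MvPolynomial.X_ne_zero _, by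
        filter_upwards [hz] with z hz
        simp [hz]⟩
    · by_cases hreal : (∀ k : ℕ, (A.coeff k).im = 0) ∧ ∀ᶠ t : ℝ in 𝓝[>] 0, (g (t : ℂ)).im = 0
      · -- real, non-rational jet: lacunarity (S), then the split over atoms and pockets
        exact hray (hSplit W hW hdim s e A g ℓu ℓv ρ N₀ T ℓ₀ ℓ₁ Φ₁ r he hρ hg hg0 hu hv
          htr hbr hrat hreal hr hT hT0 h₀ h₁ hΦ₁ hbr' hlink hDeep
          (hA3 e N₀ A g ℓu ℓv T ℓ₀ ℓ₁ Φ₁ ρ r he hρ hr hg hg0 hu hv hT hT0 h₀ h₁ hΦ₁ htr hrat hreal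
            (stub_cuspZeroLogDensity e he A g hg hg0 htr) hlink)
          (fun G β => hA2 e N₀ A g ℓu ℓv T ℓ₀ ℓ₁ Φ₁ G ρ r β he hρ hr hg hg0 hu hv hT hT0 h₀ h₁ hΦ₁ htr
            hrat hreal (stub_cuspZeroLogDensity e he A g hg hg0 htr) hlink)
          (fun G β q m₀ m₁ => hA1 e N₀ A g ℓu ℓv T ℓ₀ ℓ₁ Φ₁ G ρ r β q m₀ m₁ he hρ hr hg hg0 hu hv hT
            hT0 h₀ h₁ hΦ₁ htr hrat hreal (stub_cuspZeroLogDensity e he A g hg hg0 htr) hlink))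
      · -- non-real jet or tail: finitely many integer points outright
        exact hray ((stub_nonRealJetFinite e he A g hg hg0 hreal).subset fun N hN => hN.2.2)
  · -- (2) degenerate section
    exact hinf' ((stub_classicalClassesFinite W hW hdim).1 a b hab c)
  · -- (3) constant exponential
    exact hinf' ((stub_classicalClassesFinite W hW hdim).2 ω)

end Summit.Schanuel.Schanuel.Cruxes.SparsityTwo.CuspGermSchneiderSparsity
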